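import Summits.RiemannHypothesis.RiemannHypothesis.Theorems.WeilFormatCCinfCouplingEven
import HarnessLib

/-!
# Format C, design C∞ (E3, analytic side): the ODD `hUq` of the DoorB certificates from collected monomial data

Route context: Fourier–Galerkin / Schur-complement certificates of Weil positivity on a window ("format C", C∞ door;
cell memo `run/shared/lean/pub/rh-explicit/rh-explicit-weil-10/KERNEL-LEVER.md` §21; supporting stmt-RiemannHypothesis-0098;
seat rh-explicit-weil-10).  The odd twin of `cinf_hUq_even` (`WeilFormatCCinfCouplingEven`): for POLYNOMIAL odd profiles
`f_j(x) = Σ_{q∈s} c_{jq} x^q` (odd powers, real coefficients) it produces the coupling majorant `hUqo` of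
`weilPositivityOn_of_formatC_cinfB/BA` (kernel indices `k, m` ↔ modes `k+1, m+1`; the three analytic hypotheses are taken AT THE MODE
`m+1` in the `((m+1 : ℕ) : ℤ)` cast form that `abs_oddRow_sub_family_le` / `abs_im_image_pow_sub_family_le` /
`oddVTable_family` produce, and bridged to the kernel-index form inside) from the collected far odd rows
`|M⁻(k,m) − (−1)^{m+1} Σ_x P_row(k,x)φ_x(m)| ≤ ρ_row(k)w(m)` (`k < B`), the collected monomial images
`|Im W(1x^q, χ_{m+1}) − (−1)^{m+1} Σ_x P_img(q,x)φ_x(m)| ≤ ρ_img(q)w(m)`, the collected odd profile table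
`2 Im ĉ_{m+1}(1f_j)/√(2a) = (−1)^{m+1} Σ_x R(j,x)φ_x(m)`, and the data (`Λ₁, Λ₂, d̂, d₀, Ufin, W, Γ`), via
`im_weilWindowSesq_sub_proj_chiOdd_div`, `im_weilWindowSesq_indicator_poly_chiOdd_div`, `abs_sum_mul_sub_collected_le` and
`coupling_majorant_gram_shifted_fintype`.  Pure assembly; standard axioms; no definitions; no RH claim.
-/

set_option autoImplicit false
-- `Summit.RiemannHypothesis.RiemannHypothesis.…` is the layout-mandated namespace (summit = problem name).
set_option linter.dupNamespace false

noncomputable section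

open Complex Filter Set MeasureTheory Finset
open scoped Real Topology ComplexConjugate

namespace Summit.RiemannHypothesis.RiemannHypothesis.Theorems.WeilFormatC

open Literature.NumberTheory.LFunctions Literature.NumberTheory.LFunctions.Yoshida1992

variable {a : ℝ}

/-- An odd real polynomial window: `x ↦ Σ_{q∈s} c_q x^q` with odd powers is odd and real. -/
theorem poly_odd_real (s : Finset ℕ) (c : ℕ → ℝ) (hs : ∀ q ∈ s, Odd q) :
    (∀ x : ℝ, (fun x : ℝ ↦ ∑ q ∈ s, ((c q : ℝ) : ℂ) * ((x : ℂ)) ^ q) (-x)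
        = -(fun x : ℝ ↦ ∑ q ∈ s, ((c q : ℝ) : ℂ) * ((x : ℂ)) ^ q) x) ∧
      (∀ x : ℝ, conj ((fun x : ℝ ↦ ∑ q ∈ s, ((c q : ℝ) : ℂ) * ((x : ℂ)) ^ q) x)
        = (fun x : ℝ ↦ ∑ q ∈ s, ((c q : ℝ) : ℂ) * ((x : ℂ)) ^ q) x) := by
  refine ⟨fun x ↦ ?_, fun x ↦ ?_⟩
  · show ∑ q ∈ s, ((c q : ℝ) : ℂ) * (((-x : ℝ) : ℂ)) ^ q = -∑ q ∈ s, ((c q : ℝ) : ℂ) * ((x : ℂ)) ^ q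
    rw [← Finset.sum_neg_distrib]
    refine Finset.sum_congr rfl fun q hq ↦ ?_
    rw [Complex.ofReal_neg, (hs q hq).neg_pow]; ring
  · show conj (∑ q ∈ s, ((c q : ℝ) : ℂ) * ((x : ℂ)) ^ q) = ∑ q ∈ s, ((c q : ℝ) : ℂ) * ((x : ℂ)) ^ q
    rw [map_sum]
    refine Finset.sum_congr rfl fun q _ ↦ ?_
    rw [map_mul, map_pow, Complex.conj_ofReal, Complex.conj_ofReal]

/-- **The odd `hUq` of the DoorB certificates from collected monomial data** (kernel indices; see the module
docstring).  The conclusion is literally the `hUqo` hypothesis of `weilPositivityOn_of_formatC_cinfB(A)` for the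
polynomial profiles `fo j = Σ_{q∈s} c_{jq} x^q`, the matrix free map and
`Uqo x β = Ufin x β + ((1+θ)Γ(u(x,β)) + (1+θ⁻¹)W(Σρ)(Σρ z²))/d₀`. -/
theorem cinf_hUq_odd (ha : 0 < a) {Bo ro m₀ : ℕ} (hBm : Bo ≤ m₀) (s : Finset ℕ)
    (hs : ∀ q ∈ s, Odd q) (coef : Fin ro → ℕ → ℝ)
    {ι : Type*} [Fintype ι] (φ : ι → ℕ → ℝ) (w : ℕ → ℝ)
    -- collected rows `k < Bo` (kernel indices)
    (Prow : ℕ → ι → ℝ) (ρrow : ℕ → ℝ) (hρrow : ∀ k, 0 ≤ ρrow k)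
    (hrow : ∀ m, m₀ ≤ m → ∀ k, k < Bo →
      |((gramCoeff a ((k + 1 : ℕ) : ℤ) ((m + 1 : ℕ) : ℤ) - gramCoeff a ((k + 1 : ℕ) : ℤ) (-((m + 1 : ℕ) : ℤ))) / 2)
        - (-1 : ℝ) ^ (m + 1) * ∑ f, Prow k f * φ f m| ≤ ρrow k * w m)
    -- collected monomial images `q ∈ s` at the mode `m + 1`
    (Pimg : ℕ → ι → ℝ) (ρimg : ℕ → ℝ) (hρimg : ∀ q, 0 ≤ ρimg q)
    (himg : ∀ m, m₀ ≤ m → ∀ q ∈ s,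
      |(weilWindowSesq a ((Icc (-a) a).indicator fun x : ℝ ↦ ((x : ℂ)) ^ q) (chi a (m + 1))).im
        - (-1 : ℝ) ^ (m + 1) * ∑ f, Pimg q f * φ f m| ≤ ρimg q * w m)
    -- collected profile table (exact)
    (Rtab : Fin ro → ι → ℝ)
    (hV : ∀ m, m₀ ≤ m → ∀ j : Fin ro,
      (2 * (Yoshida1992.fourierCoeff a ((m + 1 : ℕ) : ℤ) ((Icc (-a) a).indicator fun x : ℝ ↦ ∑ q ∈ s, ((coef j q : ℝ) : ℂ) * ((x : ℂ)) ^ q)).im / Real.sqrt (2 * a))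
        = (-1 : ℝ) ^ (m + 1) * ∑ f, Rtab j f * φ f m)
    -- data: free map, far diagonal, middle range, weights, family Gram
    (Λ₁ : Fin ro → Fin Bo → ℝ) (Λ₂ : Fin ro → Fin ro → ℝ)
    (dhat : ℕ → ℝ) (hd : ∀ m, Bo ≤ m → 0 < dhat m) {d₀ : ℝ} (hd₀ : 0 < d₀) (hd₃ : ∀ m, m₀ ≤ m → d₀ ≤ dhat m)
    (Ufin : (Fin Bo → ℝ) → (Fin ro → ℝ) → ℝ)
    (hfin : ∀ (x : Fin Bo → ℝ) (β : Fin ro → ℝ),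
      ∑ m ∈ Ico Bo m₀,
        (∑ i : Fin Bo, ((gramCoeff a (((i : ℕ) : ℤ) + 1) ((m : ℤ) + 1) - gramCoeff a (((i : ℕ) : ℤ) + 1) (-((m : ℤ) + 1))) / 2) * x i
          + ∑ j, ((weilWindowSesq a ((Icc (-a) a).indicator (fun x : ℝ ↦ ∑ q ∈ s, ((coef j q : ℝ) : ℂ) * ((x : ℂ)) ^ q)
              - proj a Bo ((Icc (-a) a).indicator fun x : ℝ ↦ ∑ q ∈ s, ((coef j q : ℝ) : ℂ) * ((x : ℂ)) ^ q))
              (chiOdd a (m + 1))).im / Real.sqrt 2) * β j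
          - ∑ j, (2 * (Yoshida1992.fourierCoeff a ((m : ℤ) + 1) ((Icc (-a) a).indicator fun x : ℝ ↦ ∑ q ∈ s, ((coef j q : ℝ) : ℂ) * ((x : ℂ)) ^ q)).im / Real.sqrt (2 * a))
              * (∑ i, Λ₁ j i * x i + ∑ j', Λ₂ j j' * β j')) ^ 2 / dhat m ≤ Ufin x β)
    {W : ℝ} (hW : ∀ N, ∑ m ∈ Ico m₀ N, w m ^ 2 ≤ W)
    (Γ : (ι → ℝ) → ℝ) (hΓ : ∀ (N : ℕ) (u : ι → ℝ), ∑ m ∈ Ico m₀ N, (∑ f, u f * φ f m) ^ 2 ≤ Γ u)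
    {θ : ℝ} (hθ : 0 < θ) (N : ℕ) (x : Fin Bo → ℝ) (β : Fin ro → ℝ) :
    ∑ m ∈ Ico Bo N,
        (∑ i : Fin Bo, ((gramCoeff a (((i : ℕ) : ℤ) + 1) ((m : ℤ) + 1) - gramCoeff a (((i : ℕ) : ℤ) + 1) (-((m : ℤ) + 1))) / 2) * x i
          + ∑ j, ((weilWindowSesq a ((Icc (-a) a).indicator (fun x : ℝ ↦ ∑ q ∈ s, ((coef j q : ℝ) : ℂ) * ((x : ℂ)) ^ q)
              - proj a Bo ((Icc (-a) a).indicator fun x : ℝ ↦ ∑ q ∈ s, ((coef j q : ℝ) : ℂ) * ((x : ℂ)) ^ q))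
              (chiOdd a (m + 1))).im / Real.sqrt 2) * β j
          - ∑ j, (2 * (Yoshida1992.fourierCoeff a ((m : ℤ) + 1) ((Icc (-a) a).indicator fun x : ℝ ↦ ∑ q ∈ s, ((coef j q : ℝ) : ℂ) * ((x : ℂ)) ^ q)).im / Real.sqrt (2 * a))
              * (∑ i, Λ₁ j i * x i + ∑ j', Λ₂ j j' * β j')) ^ 2 / dhat m
      ≤ Ufin x β + ((1 + θ) * Γ (fun f ↦ ∑ i : Fin Bo, (Prow i f - ∑ j, Rtab j f * Λ₁ j i) * x i
            + ∑ j', ((∑ q ∈ s, coef j' q * Pimg q f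
                      - ∑ n ∈ Finset.Ico 0 Bo, (2 * (Yoshida1992.fourierCoeff a ((n : ℤ) + 1) ((Icc (-a) a).indicator fun x : ℝ ↦ ∑ q ∈ s, ((coef j' q : ℝ) : ℂ) * ((x : ℂ)) ^ q)).im / Real.sqrt (2 * a)) * Prow n f)
                    - ∑ j, Rtab j f * Λ₂ j j') * β j')
          + (1 + 1 / θ) * (W * ((∑ i : Fin Bo, ρrow i
                + ∑ j, (∑ q ∈ s, |coef j q| * ρimg q
                    + ∑ n ∈ Finset.Ico 0 Bo, |(2 * (Yoshida1992.fourierCoeff a ((n : ℤ) + 1) ((Icc (-a) a).indicator fun x : ℝ ↦ ∑ q ∈ s, ((coef j q : ℝ) : ℂ) * ((x : ℂ)) ^ q)).im / Real.sqrt (2 * a))| * ρrow n))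
              * (∑ i : Fin Bo, ρrow i * x i ^ 2
                + ∑ j, (∑ q ∈ s, |coef j q| * ρimg q
                    + ∑ n ∈ Finset.Ico 0 Bo, |(2 * (Yoshida1992.fourierCoeff a ((n : ℤ) + 1) ((Icc (-a) a).indicator fun x : ℝ ↦ ∑ q ∈ s, ((coef j q : ℝ) : ℂ) * ((x : ℂ)) ^ q)).im / Real.sqrt (2 * a))| * ρrow n) * β j ^ 2)))) / d₀ := by
  -- mode `m + 1` ↔ kernel index `m`: cast bridges for the rows and the profile table
  have hrow' : ∀ m, m₀ ≤ m → ∀ k, k < Bo →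
      |((gramCoeff a ((k : ℤ) + 1) ((m : ℤ) + 1) - gramCoeff a ((k : ℤ) + 1) (-((m : ℤ) + 1))) / 2)
        - (-1 : ℝ) ^ (m + 1) * ∑ f, Prow k f * φ f m| ≤ ρrow k * w m := by
    intro m hm k hk
    have h := hrow m hm k hk
    push_cast at h
    exact h
  have hV' : ∀ m, m₀ ≤ m → ∀ j : Fin ro,
      (2 * (Yoshida1992.fourierCoeff a ((m : ℤ) + 1) ((Icc (-a) a).indicator fun x : ℝ ↦ ∑ q ∈ s, ((coef j q : ℝ) : ℂ) * ((x : ℂ)) ^ q)).im / Real.sqrt (2 * a))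
        = (-1 : ℝ) ^ (m + 1) * ∑ f, Rtab j f * φ f m := by
    intro m hm j
    have h := hV m hm j
    push_cast at h
    exact h
  -- the images: projection removed, polynomial expanded, collected by linear combination
  have hc : ∀ m, m₀ ≤ m → ∀ j : Fin ro,
      |((weilWindowSesq a ((Icc (-a) a).indicator (fun x : ℝ ↦ ∑ q ∈ s, ((coef j q : ℝ) : ℂ) * ((x : ℂ)) ^ q)
              - proj a Bo ((Icc (-a) a).indicator fun x : ℝ ↦ ∑ q ∈ s, ((coef j q : ℝ) : ℂ) * ((x : ℂ)) ^ q))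
              (chiOdd a (m + 1))).im / Real.sqrt 2)
        - (-1 : ℝ) ^ (m + 1) * ∑ f, (∑ q ∈ s, coef j q * Pimg q f
              - ∑ n ∈ Finset.Ico 0 Bo, (2 * (Yoshida1992.fourierCoeff a ((n : ℤ) + 1) ((Icc (-a) a).indicator fun x : ℝ ↦ ∑ q ∈ s, ((coef j q : ℝ) : ℂ) * ((x : ℂ)) ^ q)).im / Real.sqrt (2 * a)) * Prow n f) * φ f m|
        ≤ (∑ q ∈ s, |coef j q| * ρimg q
            + ∑ n ∈ Finset.Ico 0 Bo, |(2 * (Yoshida1992.fourierCoeff a ((n : ℤ) + 1) ((Icc (-a) a).indicator fun x : ℝ ↦ ∑ q ∈ s, ((coef j q : ℝ) : ℂ) * ((x : ℂ)) ^ q)).im / Real.sqrt (2 * a))| * ρrow n) * w m := by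
    intro m hm j
    obtain ⟨hod, hre⟩ := poly_odd_real s (coef j) hs
    have hodI := indicator_odd (f := fun x : ℝ ↦ ∑ q ∈ s, ((coef j q : ℝ) : ℂ) * ((x : ℂ)) ^ q) hod a
    have hreI := indicator_real (f := fun x : ℝ ↦ ∑ q ∈ s, ((coef j q : ℝ) : ℂ) * ((x : ℂ)) ^ q) hre a
    rw [im_weilWindowSesq_sub_proj_chiOdd_div ha hodI hreI (isWindowFunction_indicator_poly a s _) Bo m,
      im_weilWindowSesq_indicator_poly_chiOdd_div ha s (coef j) (m + 1)]
    have h1 : |∑ q ∈ s, coef j q * ((1 - (-1 : ℝ) ^ q) / 2) *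
          (weilWindowSesq a ((Icc (-a) a).indicator fun x : ℝ ↦ ((x : ℂ)) ^ q) (chi a (m + 1))).im
        - (-1 : ℝ) ^ (m + 1) * ∑ f, (∑ q ∈ s, coef j q * Pimg q f) * φ f m| ≤ (∑ q ∈ s, |coef j q| * ρimg q) * w m := by
      have h := abs_sum_mul_sub_collected_le s (coef j)
        (fun q ↦ (weilWindowSesq a ((Icc (-a) a).indicator fun x : ℝ ↦ ((x : ℂ)) ^ q) (chi a (m + 1))).im)
        Pimg (fun f ↦ φ f m) ((-1 : ℝ) ^ (m + 1)) (w m) ρimg (himg m hm)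
      have e : ∑ q ∈ s, coef j q * ((1 - (-1 : ℝ) ^ q) / 2) *
            (weilWindowSesq a ((Icc (-a) a).indicator fun x : ℝ ↦ ((x : ℂ)) ^ q) (chi a (m + 1))).im
          = ∑ q ∈ s, coef j q *
            (weilWindowSesq a ((Icc (-a) a).indicator fun x : ℝ ↦ ((x : ℂ)) ^ q) (chi a (m + 1))).im :=
        Finset.sum_congr rfl fun q hq ↦ by rw [(hs q hq).neg_one_pow]; ring
      rw [e]; exact h
    have h2 : |∑ n ∈ Finset.Ico 0 Bo, ((gramCoeff a ((n : ℤ) + 1) ((m : ℤ) + 1) - gramCoeff a ((n : ℤ) + 1) (-((m : ℤ) + 1))) / 2) * (2 * (Yoshida1992.fourierCoeff a ((n : ℤ) + 1) ((Icc (-a) a).indicator fun x : ℝ ↦ ∑ q ∈ s, ((coef j q : ℝ) : ℂ) * ((x : ℂ)) ^ q)).im / Real.sqrt (2 * a))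
        - (-1 : ℝ) ^ (m + 1) * ∑ f, (∑ n ∈ Finset.Ico 0 Bo, (2 * (Yoshida1992.fourierCoeff a ((n : ℤ) + 1) ((Icc (-a) a).indicator fun x : ℝ ↦ ∑ q ∈ s, ((coef j q : ℝ) : ℂ) * ((x : ℂ)) ^ q)).im / Real.sqrt (2 * a)) * Prow n f) * φ f m|
        ≤ (∑ n ∈ Finset.Ico 0 Bo, |(2 * (Yoshida1992.fourierCoeff a ((n : ℤ) + 1) ((Icc (-a) a).indicator fun x : ℝ ↦ ∑ q ∈ s, ((coef j q : ℝ) : ℂ) * ((x : ℂ)) ^ q)).im / Real.sqrt (2 * a))| * ρrow n) * w m := by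
      have h := abs_sum_mul_sub_collected_le (Finset.Ico 0 Bo)
        (fun n ↦ (2 * (Yoshida1992.fourierCoeff a ((n : ℤ) + 1) ((Icc (-a) a).indicator fun x : ℝ ↦ ∑ q ∈ s, ((coef j q : ℝ) : ℂ) * ((x : ℂ)) ^ q)).im / Real.sqrt (2 * a)))
        (fun n ↦ ((gramCoeff a ((n : ℤ) + 1) ((m : ℤ) + 1) - gramCoeff a ((n : ℤ) + 1) (-((m : ℤ) + 1))) / 2))
        Prow (fun f ↦ φ f m) ((-1 : ℝ) ^ (m + 1)) (w m) ρrow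
        (fun n hn ↦ hrow' m hm n (Finset.mem_Ico.1 hn).2)
      have e : ∑ n ∈ Finset.Ico 0 Bo, ((gramCoeff a ((n : ℤ) + 1) ((m : ℤ) + 1) - gramCoeff a ((n : ℤ) + 1) (-((m : ℤ) + 1))) / 2) * (2 * (Yoshida1992.fourierCoeff a ((n : ℤ) + 1) ((Icc (-a) a).indicator fun x : ℝ ↦ ∑ q ∈ s, ((coef j q : ℝ) : ℂ) * ((x : ℂ)) ^ q)).im / Real.sqrt (2 * a))
          = ∑ n ∈ Finset.Ico 0 Bo, (2 * (Yoshida1992.fourierCoeff a ((n : ℤ) + 1) ((Icc (-a) a).indicator fun x : ℝ ↦ ∑ q ∈ s, ((coef j q : ℝ) : ℂ) * ((x : ℂ)) ^ q)).im / Real.sqrt (2 * a)) * ((gramCoeff a ((n : ℤ) + 1) ((m : ℤ) + 1) - gramCoeff a ((n : ℤ) + 1) (-((m : ℤ) + 1))) / 2) :=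
        Finset.sum_congr rfl fun n _ ↦ mul_comm _ _
      rw [e]; exact h
    exact abs_sub_sub_collected_le h1 h2
  -- the structured tail over `ι`
  have key := coupling_majorant_gram_shifted_fintype (ι := ι)
    (fun (k m : ℕ) ↦ ((gramCoeff a ((k : ℤ) + 1) ((m : ℤ) + 1) - gramCoeff a ((k : ℤ) + 1) (-((m : ℤ) + 1))) / 2))
    (B := Bo) (B₃ := m₀) (r := ro) hBm
    (fun m j ↦ ((weilWindowSesq a ((Icc (-a) a).indicator (fun x : ℝ ↦ ∑ q ∈ s, ((coef j q : ℝ) : ℂ) * ((x : ℂ)) ^ q)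
              - proj a Bo ((Icc (-a) a).indicator fun x : ℝ ↦ ∑ q ∈ s, ((coef j q : ℝ) : ℂ) * ((x : ℂ)) ^ q))
              (chiOdd a (m + 1))).im / Real.sqrt 2))
    (fun m j ↦ (2 * (Yoshida1992.fourierCoeff a ((m : ℤ) + 1) ((Icc (-a) a).indicator fun x : ℝ ↦ ∑ q ∈ s, ((coef j q : ℝ) : ℂ) * ((x : ℂ)) ^ q)).im / Real.sqrt (2 * a)))
    Λ₁ Λ₂ dhat hd hd₀ hd₃ Ufin hfin (fun m ↦ (-1 : ℝ) ^ (m + 1))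
    (fun m ↦ by rw [← pow_mul, mul_comm, pow_mul]; norm_num)
    φ (fun f (i : Fin Bo) ↦ Prow i f)
    (fun f j ↦ ∑ q ∈ s, coef j q * Pimg q f
        - ∑ n ∈ Finset.Ico 0 Bo, (2 * (Yoshida1992.fourierCoeff a ((n : ℤ) + 1) ((Icc (-a) a).indicator fun x : ℝ ↦ ∑ q ∈ s, ((coef j q : ℝ) : ℂ) * ((x : ℂ)) ^ q)).im / Real.sqrt (2 * a)) * Prow n f)
    (fun f j ↦ Rtab j f) w (fun i ↦ ρrow i)
    (fun j ↦ ∑ q ∈ s, |coef j q| * ρimg q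
        + ∑ n ∈ Finset.Ico 0 Bo, |(2 * (Yoshida1992.fourierCoeff a ((n : ℤ) + 1) ((Icc (-a) a).indicator fun x : ℝ ↦ ∑ q ∈ s, ((coef j q : ℝ) : ℂ) * ((x : ℂ)) ^ q)).im / Real.sqrt (2 * a))| * ρrow n)
    (fun i ↦ hρrow i)
    (fun j ↦ add_nonneg (Finset.sum_nonneg fun q _ ↦ mul_nonneg (abs_nonneg _) (hρimg q))
      (Finset.sum_nonneg fun n _ ↦ mul_nonneg (abs_nonneg _) (hρrow n)))
    (fun m hm i ↦ hrow' m hm i i.2)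
    hc (fun m hm j ↦ hV' m hm j) hW Γ hΓ hθ N x β
  exact key

end Summit.RiemannHypothesis.RiemannHypothesis.Theorems.WeilFormatC
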